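import Literature.AlgebraicGeometry.Resolution.NormalizationLocalRings
import Mathlib.RingTheory.Localization.Integral
import Mathlib.RingTheory.IntegralClosure.IntegrallyClosed
import Mathlib.Algebra.CharP.Algebra
import HarnessLib

/-!
# The base-changed local model `M = B ⊗_A A_𝔮` of an integral extension

Topic: `Literature/AlgebraicGeometry/Resolution`. For the sections `A = Γ(W, U) → B = Γ(Y^ν, V)`
of the normalised `p`-cyclic cover of the endgame of the crux `PicoverLocalModel` and a point
`w' ∈ U` with prime `𝔮 ⊆ A` and local ring `O = 𝒪_{W,w'} = A_𝔮`, the ring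
`M = B[(A ∖ 𝔮)⁻¹]` is the `O`-algebra to which the local algebra of the line applies (and which
turns out to be the local ring of `Y^ν` at the unique point over `w'`,
`IsLocalization.atPrime_of_isLocalRing`). This file collects its formal properties for ANY
`O`-algebra structure on `M` compatible with `A → O` and `A → B → M`:

* `algebraMap_localModel_eq` — the structure map `O → M` is the localization of `A → B`;
* `isIntegral_localModel`, `injective_algebraMap_localModel`, `isDomain_localModel`,
  `isIntegrallyClosed_localModel`, `charP_of_isLocalization_atPrime` — `M` is an integrally
  closed domain, integral over `O`, with `O → M` injective, in characteristic `p`;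
* `ringEquiv_comp_algebraMap_localModel` — a `B`-algebra isomorphism `M ≅ N` matches `O → M`
  with any `σ : O → N` compatible with `A → B → N`.

Sources: folklore (localization of integral extensions; EGA IV₁ §1). [Kato1994] context only.
-/

namespace Literature.AlgebraicGeometry.Resolution

open IsLocalRing

section LocalModel

variable {A B O M : Type*} [CommRing A] [CommRing B] [CommRing O] [CommRing M]
  [Algebra A B] [Algebra A O] [Algebra B M] [Algebra O M] [Algebra A M]
  [IsScalarTower A B M] [IsScalarTower A O M]
  (𝔮 : Ideal A) [𝔮.IsPrime] [IsLocalization.AtPrime O 𝔮]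
  [IsLocalization (Algebra.algebraMapSubmonoid B 𝔮.primeCompl) M]

include 𝔮 in
/-- The structure map `O → M` is the one of Mathlib's `localizationAlgebra` (the map induced on
localizations by `A → B`). [folklore] -/
theorem algebraMap_localModel_eq :
    algebraMap O M = @algebraMap O M _ _ (localizationAlgebra 𝔮.primeCompl B) := by
  refine IsLocalization.ringHom_ext 𝔮.primeCompl ?_
  change _ = (IsLocalization.map M (algebraMap A B) _).comp (algebraMap A O)
  rw [IsLocalization.map_comp, ← IsScalarTower.algebraMap_eq, ← IsScalarTower.algebraMap_eq]

include 𝔮 in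
/-- `M` is integral over `O` when `B` is integral over `A`. [folklore] -/
theorem isIntegral_localModel [Algebra.IsIntegral A B] : Algebra.IsIntegral O M := by
  rw [← algebraMap_isIntegral_iff, algebraMap_localModel_eq (A := A) (B := B) 𝔮]
  exact isIntegral_localization

include 𝔮 in
/-- `O → M` is injective when `A → B` is. [folklore] -/
theorem injective_algebraMap_localModel (hinj : Function.Injective (algebraMap A B)) :
    Function.Injective (algebraMap O M) := by
  rw [algebraMap_localModel_eq (A := A) (B := B) 𝔮]
  exact localizationAlgebra_injective _ _ hinj

omit [Algebra A O] [Algebra O M] [Algebra A M] [IsScalarTower A B M] [IsScalarTower A O M]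
  [IsLocalization.AtPrime O 𝔮] in
include 𝔮 in
/-- The image of `A ∖ 𝔮` consists of non-zero-divisors of the domain `B` (`A → B`
injective). [folklore] -/
theorem algebraMapSubmonoid_le_nonZeroDivisors [IsDomain B]
    (hinj : Function.Injective (algebraMap A B)) :
    Algebra.algebraMapSubmonoid B 𝔮.primeCompl ≤ nonZeroDivisors B := by
  intro b hb
  obtain ⟨a, ha, rfl⟩ := Submonoid.mem_map.mp hb
  refine mem_nonZeroDivisors_of_ne_zero ((map_ne_zero_iff _ hinj).mpr ?_)
  rintro rfl
  exact ha (Ideal.zero_mem 𝔮)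

omit [Algebra A O] [Algebra O M] [Algebra A M] [IsScalarTower A B M] [IsScalarTower A O M]
  [IsLocalization.AtPrime O 𝔮] in
include 𝔮 in
/-- `M` is a domain. [folklore] -/
theorem isDomain_localModel [IsDomain B] (hinj : Function.Injective (algebraMap A B)) :
    IsDomain M :=
  IsLocalization.isDomain_of_le_nonZeroDivisors M (algebraMapSubmonoid_le_nonZeroDivisors 𝔮 hinj)

omit [Algebra A O] [Algebra O M] [Algebra A M] [IsScalarTower A B M] [IsScalarTower A O M]
  [IsLocalization.AtPrime O 𝔮] in
include 𝔮 in
/-- `M` is integrally closed when `B` is. [folklore] -/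
theorem isIntegrallyClosed_localModel [IsDomain B] [IsIntegrallyClosed B]
    (hinj : Function.Injective (algebraMap A B)) : IsIntegrallyClosed M :=
  isIntegrallyClosed_of_isLocalization M _ (algebraMapSubmonoid_le_nonZeroDivisors 𝔮 hinj)

omit [IsLocalization (Algebra.algebraMapSubmonoid B 𝔮.primeCompl) M] in
include 𝔮 in
/-- **Compatibility of structure maps under `M ≅ N`.** If `e : M ≅ N` is a `B`-algebra
isomorphism and `σ : O → N` is compatible with `A → B → N`, then `e ∘ (O → M) = σ` (both are
determined by their restriction to `A`, `O` being a localization of `A`). [folklore] -/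
theorem ringEquiv_comp_algebraMap_localModel {N : Type*} [CommRing N] [Algebra B N]
    (e : M ≃ₐ[B] N) (σ : O →+* N)
    (hσ : σ.comp (algebraMap A O) = (algebraMap B N).comp (algebraMap A B)) :
    (e : M →+* N).comp (algebraMap O M) = σ := by
  refine IsLocalization.ringHom_ext 𝔮.primeCompl ?_
  rw [hσ, RingHom.comp_assoc, ← IsScalarTower.algebraMap_eq, IsScalarTower.algebraMap_eq A B M]
  ext a
  simp

end LocalModel

/-- A localization of a domain of characteristic `p` has characteristic `p`. [folklore] -/
theorem charP_of_isLocalization_of_isDomain {A O : Type*} [CommRing A] [IsDomain A] [CommRing O]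
    [Algebra A O] (S : Submonoid A) (hS : S ≤ nonZeroDivisors A) [IsLocalization S O] (p : ℕ)
    [CharP A p] : CharP O p :=
  charP_of_injective_algebraMap (IsLocalization.injective O hS) p

end Literature.AlgebraicGeometry.Resolution
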